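/-
Width seat `ym-line-sgb-p1-w3` (gen 2, seat prover-ym-line-sgb-p1-w3-g2-0), route `SteinGapBootstrap`, crux `ProbeCovFromPairLawG`
(stmt-QuantumFields-23640; alias `UProbeCovFromPairLaw`, stmt-QuantumFields-23800) — helper file 1/3: the comb-gauge identity on the
time axis and the `L¹(μ)` comparison of the equipartition probe with the Gaussian of the rescaled plaquette field.
-/
import Summits.QuantumFields.YangMills.Theorems.EquipartitionCriticalityEquipartitionPinsProbeTangentEnergyLaw
import Summits.QuantumFields.YangMills.Theorems.WeakCouplingRatesCurrency
import HarnessLib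

/-!
# `ProbeCovFromPairLawG` — helper 1: on the time axis the probe IS a function of the comb-gauge plaquette field, up to `β^{-1/2}`

NOT THE CLAY GAP: route `SteinGapBootstrap` bears on the RECORD-label rung leaf R2ξ′ `WeakCouplingRates.XiPow` (an UPPER bound on the
lattice mass gap of torus-limit states); this file proves deterministic and `L¹` estimates only.

For a site `x` on the time axis (`x_j = 0` for `j ≠ 0`, e.g. `x = n e₀`) and the plaquette `q = (x; 1, 2)`, three of the four boundary
links of `q` are comb edges, on which the complete axial gauge `Ũ = axialFix U` is trivial; the fourth is `e = (x + e₂, 1)`.  Hence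
(`TangentCombPoincare.holonomy_axialFix_of_top`, `CombBasics.axialFix_of_isComb`):

* `axis_holonomy_axialFix` — `Ũ_q = Ũ_e⁻¹`;
* `axis_plaqField` — the rescaled comb-gauge plaquette field is `Y_q^a(U) = -√β · Re tr((ρ(Ũ_e) − 1) e_a†)` EXACTLY (no defect);
* `axis_energy` — the plaquette energy is `E_q(U) = N − Re tr ρ(U_q) = N − Re tr ρ(Ũ_e)`;
* `axis_tangent` — von Neumann's chart (`stub_tangentDefect`, constant `K`) then gives, for `β ≥ 0`,
  `|Y_q|² ≤ 2 β E_q` and `2 β E_q − |Y_q|² ≤ K β E_q²`;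
* `abs_exp_sub_exp_le_sqrt` / `axis_probe_sub_gauss_le` — so the equipartition probe `P_q = exp(-2(βE_q)₊)` and the Gaussian
  `exp(-|Y_q|²)` of the field differ by at most `min(1, Kβ E_q²) ≤ √(Kβ)·E_q` pointwise, and
* `integral_abs_probe_sub_gauss_le` — by at most `√K · C₀ · β^{-1/2}` in `L¹(μ)` under the equipartition bound `∫ E_q dμ ≤ C₀/β`;
* `plaquetteObs_timeShiftLG` — the time-shifted probe `P ∘ α_n` is the probe at the axis plaquette `(n e₀; 1, 2)`.

References: S. Chatterjee, arXiv:1602.01222, §§9, 11 (axial gauge, linearisation) [arXiv160201222]; J. von Neumann, Math. Z. 30 (1929)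
3, §3 (exponential chart) [vonNeumann1929]; E. Seiler, LNP 159 (1982) Ch. 2 [SeilerLNP1982].
-/

set_option autoImplicit false

noncomputable section

open MeasureTheory
open Literature.Probability.LatticeModels Literature.MathematicalPhysics.QuantumLattice
  Literature.MathematicalPhysics.QuantumFieldTheory
open Summit.QuantumFields.YangMills.Theorems.EquipartitionPinsProbe
open Summit.QuantumFields.YangMills.Theorems.WeakCouplingRates (timeShiftLG)

namespace Summit.QuantumFields.YangMills.Theorems.SteinGapBootstrap

namespace ProbeCovFromPairLaw

/-! ### The comb gauge on the time axis -/

section Comb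

variable {G : Type} [Group G]

/-- `n e₀` is on the time axis: all its spatial coordinates vanish. [folklore] -/
theorem single_apply_eq_zero_of_ne (n : ℤ) : ∀ j : Fin 4, j ≠ 0 → (Pi.single (0 : Fin 4) n : Site 4) j = 0 :=
  fun j hj => by simp [Pi.single_eq_of_ne hj]

/-- The origin is on the time axis. [folklore] -/
theorem zero_apply_eq_zero_of_ne : ∀ j : Fin 4, j ≠ 0 → (0 : Site 4) j = 0 := fun _ _ => rfl

/-- On the axis, `Ũ_{(x;1,2)} = Ũ_{(x+e₂,1)}⁻¹`: the links `(x,1)`, `(x+e₁,2)`, `(x,2)` are comb edges. [cite: arXiv160201222, §9] -/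
theorem axis_holonomy_axialFix (U : LGConfig 4 G) {x : Site 4} (hx : ∀ j : Fin 4, j ≠ 0 → x j = 0) :
    plaquetteHolonomyZd (axialFix U) x 1 2 = (axialFix U (x + Pi.single 2 1, 1))⁻¹ := by
  have h12 : (1 : Fin 4) < 2 := by decide
  have hz : ∀ k' : Fin 4, 2 < k' → x k' = 0 := fun k' hk' => hx k' (by
    rintro rfl; exact absurd hk' (by decide))
  rw [TangentCombPoincare.holonomy_axialFix_of_top U h12 hz,
    CombBasics.axialFix_of_isComb U (fun j' hj' => hx j' (by rintro rfl; exact absurd hj' (by decide))),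
    one_mul]

variable [TopologicalSpace G] (r : LatticeRep G)

/-- `lieCoord` of the zero matrix vanishes. [folklore] -/
theorem lieCoord_zero (a : Fin (lieDim r)) : lieCoord r 0 a = 0 := by
  simp [lieCoord]

/-- The link field vanishes on comb edges (`Ũ = 1` there). [cite: arXiv160201222, §9] -/
theorem linkField_of_isComb (β : ℝ) (U : LGConfig 4 G) {y : Site 4} {j : Fin 4}
    (hc : ∀ j' : Fin 4, j < j' → y j' = 0) (a : Fin (lieDim r)) :
    linkField r β U (y, j) a = 0 := by
  rw [linkField, CombBasics.axialFix_of_isComb U hc, map_one, sub_self, lieCoord_zero, mul_zero]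

/-- **The axis identity**: for `x` on the time axis, the rescaled comb-gauge plaquette field at `q = (x; 1, 2)` is
`Y_q^a(U) = -√β · Re tr((ρ(Ũ_{(x+e₂,1)}) − 1) e_a†)` exactly. [cite: arXiv160201222, §9] -/
theorem axis_plaqField (β : ℝ) (U : LGConfig 4 G) {x : Site 4} (hx : ∀ j : Fin 4, j ≠ 0 → x j = 0) (a : Fin (lieDim r)) :
    plaqField r β U (plaquette12 (d := 4) (by norm_num) x) a =
      -(Real.sqrt β * lieCoord r (r.ρ (axialFix U (x + Pi.single 2 1, 1)) - 1) a) := by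
  have h1 : linkField r β U (x, 1) a = 0 :=
    linkField_of_isComb r β U (fun j' hj' => hx j' (by rintro rfl; exact absurd hj' (by decide))) a
  have h2 : linkField r β U (x + Pi.single 1 1, 2) a = 0 :=
    linkField_of_isComb r β U (fun j' hj' => by
      rw [Pi.add_apply, hx j' (by rintro rfl; exact absurd hj' (by decide)),
        Pi.single_eq_of_ne (by rintro rfl; exact absurd hj' (by decide)), add_zero]) a
  have h3 : linkField r β U (x, 2) a = 0 :=
    linkField_of_isComb r β U (fun j' hj' => hx j' (by rintro rfl; exact absurd hj' (by decide))) a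
  rw [plaqField, plaquetteCurl_eq]
  show linkField r β U (x, 1) a + linkField r β U (x + Pi.single 1 1, 2) a -
      linkField r β U (x + Pi.single 2 1, 1) a - linkField r β U (x, 2) a = _
  rw [h1, h2, h3, zero_add, sub_zero, zero_sub, linkField]

/-- **The axis energy identity**: `N − Re tr ρ(U_{(x;1,2)}) = N − Re tr ρ(Ũ_{(x+e₂,1)})` for `x` on the time axis
(gauge invariance of the plaquette observable, `Ũ_q = Ũ_e⁻¹`, `Re tr ρ(g⁻¹) = Re tr ρ(g)`). [cite: arXiv160201222, §9] -/
theorem axis_energy (U : LGConfig 4 G) {x : Site 4} (hx : ∀ j : Fin 4, j ≠ 0 → x j = 0) :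
    (r.N : ℝ) - plaquetteObs r.ρ x 1 2 U = (r.N : ℝ) - (r.ρ (axialFix U (x + Pi.single 2 1, 1))).trace.re := by
  rw [← TangentEnergyLaw.re_trace_holonomy_axialFix r.ρ U x 1 2, axis_holonomy_axialFix U hx,
    TangentCombPoincare.re_trace_map_inv r.ρ r.mem_unitary]

/-- **Tangency on the axis** (von Neumann's chart, `stub_tangentDefect`): with the chart constant `K` of `r`, for `β ≥ 0` and `x` on
the time axis, `|Y_q|² ≤ 2βE_q` and `2βE_q − |Y_q|² ≤ K β E_q²` (`q = (x;1,2)`, `E_q = N − Re tr ρ(U_q)`). [cite: vonNeumann1929, §3] -/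
theorem axis_tangent [CompactSpace G] {K : ℝ}
    (hK : ∀ g : G, 0 ≤ 2 * ((r.N : ℝ) - (r.ρ g).trace.re) - ∑ a, (lieCoord r (r.ρ g - 1) a) ^ 2 ∧
      2 * ((r.N : ℝ) - (r.ρ g).trace.re) - ∑ a, (lieCoord r (r.ρ g - 1) a) ^ 2 ≤ K * ((r.N : ℝ) - (r.ρ g).trace.re) ^ 2)
    {β : ℝ} (hβ : 0 ≤ β) (U : LGConfig 4 G) {x : Site 4} (hx : ∀ j : Fin 4, j ≠ 0 → x j = 0) :
    ∑ a, (plaqField r β U (plaquette12 (d := 4) (by norm_num) x) a) ^ 2 ≤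
        2 * (β * ((r.N : ℝ) - plaquetteObs r.ρ x 1 2 U)) ∧
      2 * (β * ((r.N : ℝ) - plaquetteObs r.ρ x 1 2 U)) -
          ∑ a, (plaqField r β U (plaquette12 (d := 4) (by norm_num) x) a) ^ 2 ≤
        K * β * ((r.N : ℝ) - plaquetteObs r.ρ x 1 2 U) ^ 2 := by
  set g : G := axialFix U (x + Pi.single 2 1, 1) with hg
  have hY : ∀ a, (plaqField r β U (plaquette12 (d := 4) (by norm_num) x) a) ^ 2 =
      β * (lieCoord r (r.ρ g - 1) a) ^ 2 := fun a => by
    rw [axis_plaqField r β U hx a, neg_sq, mul_pow, Real.sq_sqrt hβ]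
  simp only [hY, ← Finset.mul_sum, axis_energy r U hx]
  obtain ⟨h0, h1⟩ := hK g
  constructor
  · nlinarith [mul_le_mul_of_nonneg_left h0 hβ]
  · nlinarith [mul_le_mul_of_nonneg_left h1 hβ]

end Comb

/-! ### The probe versus the Gaussian of the field -/

/-- **Real-variable core**: if `0 ≤ s ≤ 2u` and `2u − s ≤ v`, then `|e^{-2u} − e^{-s}| ≤ min(1, v) ≤ √v`
(`1 − e^{-t} ≤ t`, both exponentials in `[0, 1]`, `min(1,v) ≤ √v`). [folklore] -/
theorem abs_exp_sub_exp_le_sqrt {u s v : ℝ} (hs : 0 ≤ s) (hsu : s ≤ 2 * u) (hv : 2 * u - s ≤ v) :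
    |Real.exp (-(2 * u)) - Real.exp (-s)| ≤ Real.sqrt v := by
  have hv0 : 0 ≤ v := le_trans (by linarith) hv
  have hle : Real.exp (-(2 * u)) ≤ Real.exp (-s) := Real.exp_le_exp.mpr (by linarith)
  rw [abs_sub_comm, abs_of_nonneg (sub_nonneg.mpr hle)]
  have h1 : Real.exp (-s) ≤ 1 := Real.exp_le_one_iff.mpr (by linarith)
  -- `e^{-s} − e^{-2u} = e^{-s}(1 − e^{-(2u−s)}) ≤ 2u − s ≤ v`
  have hfac : Real.exp (-s) - Real.exp (-(2 * u)) = Real.exp (-s) * (1 - Real.exp (-(2 * u - s))) := by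
    rw [mul_sub, mul_one, ← Real.exp_add]; ring_nf
  have hA : Real.exp (-s) - Real.exp (-(2 * u)) ≤ v := by
    rw [hfac]
    have h2 : 1 - Real.exp (-(2 * u - s)) ≤ 2 * u - s := by linarith [Real.add_one_le_exp (-(2 * u - s))]
    have h3 : 0 ≤ 1 - Real.exp (-(2 * u - s)) := by
      rw [sub_nonneg]; exact Real.exp_le_one_iff.mpr (by linarith)
    calc Real.exp (-s) * (1 - Real.exp (-(2 * u - s))) ≤ 1 * (2 * u - s) := mul_le_mul h1 h2 h3 zero_le_one
      _ ≤ v := by rw [one_mul]; exact hv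
  have hB : Real.exp (-s) - Real.exp (-(2 * u)) ≤ 1 := by linarith [Real.exp_pos (-(2 * u))]
  by_cases h : v ≤ 1
  · calc Real.exp (-s) - Real.exp (-(2 * u)) ≤ v := hA
      _ = Real.sqrt v * Real.sqrt v := (Real.mul_self_sqrt hv0).symm
      _ ≤ Real.sqrt v * 1 := mul_le_mul_of_nonneg_left (Real.sqrt_le_one.mpr h) (Real.sqrt_nonneg _)
      _ = Real.sqrt v := mul_one _
  · exact le_trans hB (Real.one_le_sqrt.mpr (le_of_lt (not_le.mp h)))

section Probe

variable {G : Type} [Group G] [TopologicalSpace G] (r : LatticeRep G)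

/-- `0 ≤ P_x ≤ 1` for the equipartition probe `P_x(U) = exp(-2 (β (N − Re tr ρ(U_{(x;1,2)})))₊)`. [folklore] -/
theorem probe_nonneg_le_one (β : ℝ) (x : Site 4) (U : LGConfig 4 G) :
    0 ≤ Real.exp (-2 * max (β * ((r.N : ℝ) - plaquetteObs r.ρ x 1 2 U)) 0) ∧
      Real.exp (-2 * max (β * ((r.N : ℝ) - plaquetteObs r.ρ x 1 2 U)) 0) ≤ 1 :=
  ⟨(Real.exp_pos _).le, Real.exp_le_one_iff.mpr (by
    have := le_max_right (β * ((r.N : ℝ) - plaquetteObs r.ρ x 1 2 U)) 0; nlinarith)⟩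

/-- `0 ≤ exp(-|Y_q|²) ≤ 1` for the Gaussian of the rescaled plaquette field at `q = (x;1,2)`. [folklore] -/
theorem gauss_nonneg_le_one (β : ℝ) (x : Site 4) (U : LGConfig 4 G) :
    0 ≤ Real.exp (-∑ a, (plaqField r β U (plaquette12 (d := 4) (by norm_num) x) a) ^ 2) ∧
      Real.exp (-∑ a, (plaqField r β U (plaquette12 (d := 4) (by norm_num) x) a) ^ 2) ≤ 1 :=
  ⟨(Real.exp_pos _).le, Real.exp_le_one_iff.mpr (by
    have := Finset.sum_nonneg (fun a (_ : a ∈ Finset.univ) =>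
      sq_nonneg (plaqField r β U (plaquette12 (d := 4) (by norm_num) x) a)); linarith)⟩

/-- **Pointwise comparison on the axis**: for `β ≥ 0`, `x` on the time axis and the chart constant `K`,
`|P_x(U) − exp(-|Y_{(x;1,2)}(U)|²)| ≤ √(Kβ) · (N − Re tr ρ(U_{(x;1,2)}))`. [cite: vonNeumann1929, §3] -/
theorem axis_probe_sub_gauss_le [CompactSpace G] {K : ℝ}
    (hK : ∀ g : G, 0 ≤ 2 * ((r.N : ℝ) - (r.ρ g).trace.re) - ∑ a, (lieCoord r (r.ρ g - 1) a) ^ 2 ∧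
      2 * ((r.N : ℝ) - (r.ρ g).trace.re) - ∑ a, (lieCoord r (r.ρ g - 1) a) ^ 2 ≤ K * ((r.N : ℝ) - (r.ρ g).trace.re) ^ 2)
    {β : ℝ} (hβ : 0 ≤ β) (U : LGConfig 4 G) {x : Site 4} (hx : ∀ j : Fin 4, j ≠ 0 → x j = 0) :
    |Real.exp (-2 * max (β * ((r.N : ℝ) - plaquetteObs r.ρ x 1 2 U)) 0) -
        Real.exp (-∑ a, (plaqField r β U (plaquette12 (d := 4) (by norm_num) x) a) ^ 2)| ≤
      Real.sqrt (K * β) * ((r.N : ℝ) - plaquetteObs r.ρ x 1 2 U) := by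
  set E : ℝ := (r.N : ℝ) - plaquetteObs r.ρ x 1 2 U with hE
  have hE0 : 0 ≤ E := TangentPlaquetteEnergy.sub_plaquetteObs_nonneg r.ρ r.mem_unitary x 1 2 U
  have hβE : 0 ≤ β * E := mul_nonneg hβ hE0
  obtain ⟨h1, h2⟩ := axis_tangent r hK hβ U hx
  have hP : Real.exp (-2 * max (β * E) 0) = Real.exp (-(2 * (β * E))) := by
    rw [max_eq_left hβE]; ring_nf
  rw [hP]
  refine le_trans (abs_exp_sub_exp_le_sqrt (Finset.sum_nonneg fun a _ => sq_nonneg _) h1 h2) (le_of_eq ?_)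
  rw [show K * β * E ^ 2 = (K * β) * E ^ 2 by ring, Real.sqrt_mul' _ (sq_nonneg E), Real.sqrt_sq hE0]

variable [IsTopologicalGroup G]

/-- The probe is continuous in the configuration. [folklore] -/
theorem continuous_probe (β : ℝ) (x : Site 4) :
    Continuous fun U : LGConfig 4 G => Real.exp (-2 * max (β * ((r.N : ℝ) - plaquetteObs r.ρ x 1 2 U)) 0) := by
  have h := continuous_plaquetteObs r.ρ r.continuous x (1 : Fin 4) 2 (G := G)
  fun_prop

/-- The Gaussian of the field is continuous in the configuration. [folklore] -/
theorem continuous_gauss (β : ℝ) (x : Site 4) :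
    Continuous fun U : LGConfig 4 G => Real.exp (-∑ a, (plaqField r β U (plaquette12 (d := 4) (by norm_num) x) a) ^ 2) := by
  have h := fun a => TangentPlaqFieldContinuous.continuous_plaqField_apply (G := G) r β
    (plaquette12 (d := 4) (by norm_num) x) a
  fun_prop

variable [MeasurableSpace G] [BorelSpace G] [SecondCountableTopology G]

/-- The probe is integrable under any finite measure. [folklore] -/
theorem integrable_probe (β : ℝ) (x : Site 4) (μ : Measure (LGConfig 4 G)) [IsFiniteMeasure μ] :
    Integrable (fun U : LGConfig 4 G => Real.exp (-2 * max (β * ((r.N : ℝ) - plaquetteObs r.ρ x 1 2 U)) 0)) μ :=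
  Integrable.of_bound (continuous_probe r β x).aestronglyMeasurable 1
    (ae_of_all _ fun U => by
      rw [Real.norm_eq_abs, abs_of_nonneg (probe_nonneg_le_one r β x U).1]
      exact (probe_nonneg_le_one r β x U).2)

/-- The Gaussian of the field is integrable under any finite measure. [folklore] -/
theorem integrable_gauss (β : ℝ) (x : Site 4) (μ : Measure (LGConfig 4 G)) [IsFiniteMeasure μ] :
    Integrable (fun U : LGConfig 4 G =>
      Real.exp (-∑ a, (plaqField r β U (plaquette12 (d := 4) (by norm_num) x) a) ^ 2)) μ :=
  Integrable.of_bound (continuous_gauss r β x).aestronglyMeasurable 1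
    (ae_of_all _ fun U => by
      rw [Real.norm_eq_abs, abs_of_nonneg (gauss_nonneg_le_one r β x U).1]
      exact (gauss_nonneg_le_one r β x U).2)

/-- **`L¹` comparison under equipartition**: for `β > 0`, `x` on the time axis, the chart constant `K` and a finite measure `μ`
with `∫ (N − Re tr ρ(U_{(x;1,2)})) dμ ≤ C₀/β`: `∫ |P_x − exp(-|Y_{(x;1,2)}|²)| dμ ≤ √K · C₀ · β^{-1/2}`.
[cite: arXiv160201222, §11] -/
theorem integral_abs_probe_sub_gauss_le [CompactSpace G] {K : ℝ}
    (hK : ∀ g : G, 0 ≤ 2 * ((r.N : ℝ) - (r.ρ g).trace.re) - ∑ a, (lieCoord r (r.ρ g - 1) a) ^ 2 ∧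
      2 * ((r.N : ℝ) - (r.ρ g).trace.re) - ∑ a, (lieCoord r (r.ρ g - 1) a) ^ 2 ≤ K * ((r.N : ℝ) - (r.ρ g).trace.re) ^ 2)
    {β : ℝ} (hβ : 0 < β) (μ : Measure (LGConfig 4 G)) [IsFiniteMeasure μ] {x : Site 4}
    (hx : ∀ j : Fin 4, j ≠ 0 → x j = 0) {C₀ : ℝ}
    (hequi : ∫ U, ((r.N : ℝ) - plaquetteObs r.ρ x 1 2 U) ∂μ ≤ C₀ / β) :
    ∫ U, |Real.exp (-2 * max (β * ((r.N : ℝ) - plaquetteObs r.ρ x 1 2 U)) 0) -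
        Real.exp (-∑ a, (plaqField r β U (plaquette12 (d := 4) (by norm_num) x) a) ^ 2)| ∂μ ≤
      Real.sqrt K * C₀ * β ^ (-(1 / 2 : ℝ)) := by
  have hpt : ∀ U : LGConfig 4 G, |Real.exp (-2 * max (β * ((r.N : ℝ) - plaquetteObs r.ρ x 1 2 U)) 0) -
      Real.exp (-∑ a, (plaqField r β U (plaquette12 (d := 4) (by norm_num) x) a) ^ 2)| ≤
      Real.sqrt (K * β) * ((r.N : ℝ) - plaquetteObs r.ρ x 1 2 U) := fun U =>
    axis_probe_sub_gauss_le r hK hβ.le U hx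
  have hint : Integrable (fun U => (r.N : ℝ) - plaquetteObs r.ρ x 1 2 U) μ :=
    TangentPlaquetteEnergy.integrable_sub_plaquetteObs r.ρ r.continuous r.mem_unitary μ x 1 2
  calc ∫ U, |Real.exp (-2 * max (β * ((r.N : ℝ) - plaquetteObs r.ρ x 1 2 U)) 0) -
        Real.exp (-∑ a, (plaqField r β U (plaquette12 (d := 4) (by norm_num) x) a) ^ 2)| ∂μ
      ≤ ∫ U, Real.sqrt (K * β) * ((r.N : ℝ) - plaquetteObs r.ρ x 1 2 U) ∂μ :=
        integral_mono_of_nonneg (ae_of_all _ fun U => abs_nonneg _) (hint.const_mul _) (ae_of_all _ hpt)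
    _ = Real.sqrt (K * β) * ∫ U, ((r.N : ℝ) - plaquetteObs r.ρ x 1 2 U) ∂μ := integral_const_mul _ _
    _ ≤ Real.sqrt (K * β) * (C₀ / β) := mul_le_mul_of_nonneg_left hequi (Real.sqrt_nonneg _)
    _ = Real.sqrt K * C₀ * β ^ (-(1 / 2 : ℝ)) := by
        rw [Real.sqrt_mul' _ hβ.le, Real.sqrt_eq_rpow β, Real.rpow_neg hβ.le, div_eq_mul_inv]
        have hb : β ^ (1 / 2 : ℝ) ≠ 0 := (Real.rpow_pos_of_pos hβ _).ne'
        have hb2 : β = β ^ (1 / 2 : ℝ) * β ^ (1 / 2 : ℝ) := by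
          rw [← Real.rpow_add hβ]; norm_num
        have hβinv : β⁻¹ = (β ^ (1 / 2 : ℝ))⁻¹ * (β ^ (1 / 2 : ℝ))⁻¹ := by
          rw [← mul_inv, ← hb2]
        calc Real.sqrt K * β ^ (1 / 2 : ℝ) * (C₀ * β⁻¹)
            = Real.sqrt K * C₀ * (β ^ (1 / 2 : ℝ))⁻¹ * (β ^ (1 / 2 : ℝ) * (β ^ (1 / 2 : ℝ))⁻¹) := by
              rw [hβinv]; ring
          _ = Real.sqrt K * C₀ * (β ^ (1 / 2 : ℝ))⁻¹ := by rw [mul_inv_cancel₀ hb, mul_one]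

omit [IsTopologicalGroup G] [BorelSpace G] [SecondCountableTopology G] in
/-- **The time-shifted probe is the axis probe**: `Re tr ρ((α_n U)_{(0;1,2)}) = Re tr ρ(U_{(n e₀;1,2)})`
(`α_n = configShift (−n e₀)`). [folklore] -/
theorem plaquetteObs_timeShiftLG (n : ℕ) (U : LGConfig 4 G) :
    plaquetteObs r.ρ 0 1 2 (timeShiftLG (G := G) n U) = plaquetteObs r.ρ (Pi.single 0 (n : ℤ)) 1 2 U := by
  rw [timeShiftLG, TangentPlaquetteEnergy.plaquetteObs_configShift]
  simp

end Probe

end ProbeCovFromPairLaw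

end Summit.QuantumFields.YangMills.Theorems.SteinGapBootstrap

end
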